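import Summits.CriticalPhenomena.SAWScalingLimit.Theorems.SAWLeftRightFKGFKGToTraversalBoundNecklaceEventual
import HarnessLib

/-!
# Slit necklace, last arrow: per-shell EVENTUAL tightness gives (H1) for one approximation

Crux `SAWLeftRightFKG.FKGToTraversalBound` (stmt-CriticalPhenomena-1878), line `slit-necklace`,
registered stub `stub_eventualShellReduction`.

The line proves the crux as `PA → UniformShellTight → (per-shell eventual tightness for each endpoint
approximation) → (H1)`.  This file is the last arrow, for ONE endpoint approximation `(D, a, b)`:
from per-shell eventual tightness of the traversal counts at modulus `2` (for every shell
`D(x; ρ, R)`, `0 < ρ`, `2ρ ≤ R ≤ 1`, and every `ε > 0`, some threshold `n` has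
`P_δ(n separate traversals) ≤ ε` for all sufficiently small meshes `δ`) to the body of
`SAWTraversalBound` for this approximation, with the chart `K = 2³ = 8`, `λ = 3`.

* Step 1 (`GatesByBubbleDoorsByFKG.necklace_shellTightOn_of_eventually`, trivial mesh class): the
  eventual hypothesis IS the sibling line's currency `ShellTightOn (fun _ => True) 2 D a b` (one
  `δ₀ = 1`; the large-mesh regime is handled by emptiness of the traversal event).
* Step 2 (quantile): `k(x, ρ, R) :=` the `8 (ρ/R)³`-quantile threshold of the shell when
  `2ρ ≤ R ≤ 1`, and `0` otherwise — there `8 (ρ/R)³ > 1 ≥ law` is free.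

The hypothesis `IsEndpointApprox D a b` is not used.  Only theorems; axioms are the standard three.
-/

noncomputable section

open MeasureTheory Filter Topology Set Metric
open scoped NNReal ENNReal
open Literature.Probability.LatticeModels
open Literature.Probability.RandomPlanarGeometry
open Literature.Probability.RandomPlanarGeometry.SAW
open Summit.CriticalPhenomena.SAWScalingLimit.Theses.SAWLeftRightFKG
open Summit.CriticalPhenomena.SAWScalingLimit.Theorems.FKGToTraversalBound.GatesByBubbleDoorsByFKG

namespace Summit.CriticalPhenomena.SAWScalingLimit.Theorems.FKGToTraversalBound.SlitNecklace

/-- Whatever the junk conventions, the SAW law gives mass at most `1` to every event. [folklore] -/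
private theorem eventualShellReduction_law_le_one (Ω : Set ℂ) (δ : ℝ) (u v : Site 2)
    (S : Set (DomainSAW Ω δ u v)) : law Ω δ u v S ≤ 1 := by
  calc law Ω δ u v S ≤ law Ω δ u v Set.univ := measure_mono (Set.subset_univ _)
    _ = (weight Ω δ u v Set.univ)⁻¹ * weight Ω δ u v Set.univ := by
        rw [law, Measure.smul_apply, smul_eq_mul]
    _ ≤ 1 := ENNReal.inv_mul_le_one _

/-- The target probability `2³ (ρ/R)³` of a shell of modulus `≥ 2` is positive. [folklore] -/
private theorem eventualShellReduction_eps_pos {ρ R : ℝ} (hρ : 0 < ρ) (h : 2 * ρ ≤ R) :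
    0 < (2 : ℝ) ^ 3 * (ρ / R) ^ 3 := by
  have hR : 0 < R := lt_of_lt_of_le (by positivity) h
  positivity

/-- Real power with exponent `3` is the monomial. [folklore] -/
private theorem eventualShellReduction_rpow_three (t : ℝ) : t ^ (3 : ℝ) = t ^ (3 : ℕ) := by
  rw [← Real.rpow_natCast]; norm_num

/-- **Registered stub `stub_eventualShellReduction`** (crux stmt-CriticalPhenomena-1878, line
`slit-necklace`): **per-shell eventual tightness at modulus `2` ⇒ (H1) for this approximation**, with
`K = 2³`, `λ = 3`, `δ₀` from `ShellTightOn (fun _ => True) 2 D a b`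
(`necklace_shellTightOn_of_eventually`) and the threshold `k(x, ρ, R) :=` the `2³(ρ/R)³`-quantile of
the traversal count when `2ρ ≤ R ≤ 1` (and `0` otherwise, where `K (ρ/R)³ > 1 ≥ law` is free).
[folklore] -/
theorem stub_eventualShellReduction : ∀ (D : DobrushinDomain) (a b : ℝ → Site 2), IsEndpointApprox D a b → (∀ (x : ℂ) (ρ R : ℝ), 0 < ρ → 2 * ρ ≤ R → R ≤ 1 → ∀ ε : ℝ, 0 < ε → ∃ n : ℕ, ∀ᶠ δ in 𝓝[>] (0 : ℝ), law D.carrier δ (a δ) (b δ) {γ | (⟨γ.walk.toCurve (meshPoint δ)⟩ : Curve ℂ).HasTraversals n x ρ R} ≤ ENNReal.ofReal ε) → ∃ (k : ℂ → ℝ → ℝ → ℕ) (K lam δ₀ : ℝ), 0 ≤ K ∧ 2 < lam ∧ 0 < δ₀ ∧ ∀ δ ∈ Set.Ioc (0 : ℝ) δ₀, ∀ (x : ℂ) (ρ R : ℝ), δ ≤ ρ → ρ < R → R ≤ 1 → law D.carrier δ (a δ) (b δ) {γ | (⟨γ.walk.toCurve (meshPoint δ)⟩ : Curve ℂ).HasTraversals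 (k x ρ R) x ρ R} ≤ ENNReal.ofReal (K * (ρ / R) ^ lam) := by
  classical
  intro D a b _ h
  -- Step 1: the eventual hypothesis is `ShellTightOn` on the class of all meshes at modulus `2`.
  have hST : ShellTightOn (fun _ => True) 2 D a b :=
    necklace_shellTightOn_of_eventually (fun _ => True) 2 D a b one_lt_two
      (fun x ρ R hρ h2 hR ε hε => (h x ρ R hρ h2 hR ε hε).imp fun n hn => hn.mono fun δ hδ _ => hδ)
  -- Step 2: the quantile argument.
  obtain ⟨δ₀, hδ₀, H⟩ := hST
  choose n hn using H
  set k : ℂ → ℝ → ℝ → ℕ := fun x ρ R =>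
    if hc : 0 < ρ ∧ 2 * ρ ≤ R ∧ R ≤ 1 then
      n x ρ R hc.1 hc.2.1 hc.2.2 ((2 : ℝ) ^ 3 * (ρ / R) ^ 3)
        (eventualShellReduction_eps_pos hc.1 hc.2.1)
    else 0 with hk
  refine ⟨k, (2 : ℝ) ^ 3, 3, δ₀, by positivity, by norm_num, hδ₀, ?_⟩
  intro δ hδ x ρ R hδρ hρR hR1
  have hρ : 0 < ρ := hδ.1.trans_le hδρ
  have hR : 0 < R := hρ.trans hρR
  rw [eventualShellReduction_rpow_three]
  by_cases hcase : 2 * ρ ≤ R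
  · have hkx : k x ρ R =
        n x ρ R hρ hcase hR1 ((2 : ℝ) ^ 3 * (ρ / R) ^ 3)
          (eventualShellReduction_eps_pos hρ hcase) := by
      simp only [hk, dif_pos (And.intro hρ (And.intro hcase hR1))]
    rw [hkx]
    exact hn x ρ R hρ hcase hR1 _ _ δ hδ hδρ trivial
  · have hcase : R < 2 * ρ := lt_of_not_ge hcase
    have hbig : (1 : ℝ) ≤ (2 : ℝ) ^ 3 * (ρ / R) ^ 3 := by
      have h1 : 1 < 2 * (ρ / R) := by
        rw [mul_div_assoc', lt_div_iff₀ hR]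
        linarith
      have h2 : (1 : ℝ) ≤ (2 * (ρ / R)) ^ 3 := one_le_pow₀ h1.le
      calc (1 : ℝ) ≤ (2 * (ρ / R)) ^ 3 := h2
        _ = (2 : ℝ) ^ 3 * (ρ / R) ^ 3 := by ring
    calc law D.carrier δ (a δ) (b δ)
          {γ | (⟨γ.walk.toCurve (meshPoint δ)⟩ : Curve ℂ).HasTraversals (k x ρ R) x ρ R}
        ≤ 1 := eventualShellReduction_law_le_one _ _ _ _ _
      _ ≤ ENNReal.ofReal ((2 : ℝ) ^ 3 * (ρ / R) ^ 3) := ENNReal.one_le_ofReal.2 hbig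

end Summit.CriticalPhenomena.SAWScalingLimit.Theorems.FKGToTraversalBound.SlitNecklace

end
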